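import Summits.NavierStokesRegularity.NavierStokesRegularity.Theorems.ScenarioCensusRowF1ax
import Summits.NavierStokesRegularity.NavierStokesRegularity.Theorems.TypeICertificateLadderRungZero
import Literature.Analysis.FluidPDE.BarkerPrange2020VorticityAlignmentTypeIHolds
import Literature.Analysis.FluidPDE.TypeIAncientMildTimeAnalytic
import Literature.Analysis.FluidPDE.TypeIAncientMildRescale
import Summits.NavierStokesRegularity.NavierStokesRegularity.Theorems.LocalHelicityTubeDoorFrobeniusProfileRigidityHelicalSlice
import HarnessLib
import Summits.NavierStokesRegularity.NavierStokesRegularity.Theorems.ExtremiserTransienceNearExtremalTransiencePerFlowAxisymmetricTypeILiouville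
import Literature.Analysis.FluidPDE.CurlFreeLiouville
import Literature.Analysis.FluidPDE.VectorCalculusProofs
import Literature.Analysis.FluidPDE.VorticityCalculus
import Summits.NavierStokesRegularity.NavierStokesRegularity.Theorems.ScenarioCensusRowF1WhirlTopRows
import Summits.NavierStokesRegularity.NavierStokesRegularity.Theorems.ScenarioCensusPeriodicSlabSwirlFlux
import Summits.NavierStokesRegularity.NavierStokesRegularity.Theorems.SoloSalvageWu2026HarmonicCutoff
import Summits.NavierStokesRegularity.NavierStokesRegularity.Theorems.UnthreadedRigidityDoorUnthreadedRigidityProfileHornZonalAxis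

/-!
# Census row F1, VORTEX LINES ON KILLING ORBITS — ring tops and helical ring tops read on the VORTICITY of SNAPSHOTS (cells F1rx / F1krx; floors RGF / HRF) — LINE 44 «ring-top» port,
# part 1/6: §1 objects (frame of LINES 34–42 BY NAME; the vortex-line read-outs: tangency defects of the vorticity to circles / helices plus the point pins; floors `RingFloor` /
# `HelicalRingFloor`, rows `Row_F1rx` / `Row_F1krx`)

Re-homed for the scenario census (typer seat ns-census-typer-1 g10; the cells F1rx / F1krx and the floors are members of row F1 «DECIDED IN KERNEL IN FILES» (LINE 44: ref ns-census-ref g16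
PRE-CHECK ✓ §21.18, critic PASS, lead booking OF RECORD at census v1.133); this port makes them TREE-decided): VERBATIM PORT of ns-idea-3 LINE 44 «ring-top»,
`pub/ideators/ns-idea-3/lines/ring-top/line-ring-top.lean` sha16 74d818dbb34ba3da (1774 l., lean check rc 0, 0 sorry), split for the 400-line rule into `ScenarioCensusRowF1RingTop`
(§1) → `…RingTopZoom` (§2–§3) → `…RingTopCovariance` (§4a) → `…RingTopKill` (§4b) → `…RingTopFloors` (§5) → `…RingTopRows` (§6–§7 + census KEYS).  Lean text VERBATIM in namespace
`…Theorems.ScenarioCensus.RingTop` (the line's `…Cruxes.ScenarioCensusRowF1.RingTopLine` re-homed); port edits: the frame restated VERBATIM by the line from LINES 34–42 (`topSet`,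
`HasTypeIConstant`, `snapLevel`, `exists_fast_at`, `sqrt_mul_sq_mul`, `continuous_slice'`, `rotLin`, `rotCLM`, `coe_rotCLM`, `analyticAt_transport`, `rotZ_smul_eZ'`, `zoom_units`,
`eventually_forall_not_of_not_frequently`, `le_of_units`) is taken BY NAME from the landed ports (the line's own STRENGTHENED compactness / socket / zoom package / `tendsto_eval` with gradients are new statements and kept; `row_of_floor` = `ScalingTop.row_of_floor` BY NAME); elementary lemmas the line restates are the tree's BY NAME (`rotZ_add_vec'` / `rotZ_add_smul_eZ'` = `ScrewBlowdown.…`,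
`rotZ_smul_vec'` = `rotZ_smul`, `rotZ_neg_rotZ'` / `rotZ_rotZ_neg'` = `RotationOrder.…`, `rotZ_zero_vec'` = `rotZ_apply_zero_vec`, `curl_const_smul'` = `curl_const_smul_field`, `continuous_rotZ`,
`centre_mem` = `IsTypeIAncientMild.comp_add_right`, `hasDerivAt_rotZ_rotGen'` = `AxisymEndLiouville.AbsorbingAxisSwirlExtinction.hasDerivAt_rotZ_rotGen`, `rotGen_add_smul_eZ'` =
`PeriodicSlab.rotGen_add_smul_eZ`, `inner_gradient_eq_fderiv` = `Wu2026Salvage.inner_gradient_right_eq`, `rotZ_single_two` = `UnthreadedRigidity.ProfileHorn.rotZ_single_two'` — cone-free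
modules imported); `tendstoLocallyUniformly_comp_of_tendsto`, `analyticAt_linIso`, `smul_coord` (twins of lemmas in route-cone modules) are not re-declared (inlined / replaced by
`PiLp.smul_apply, smul_eq_mul`); `@[conjecture]` on the residual `RingCollapse` (≡ `ScenarioCensus.Row_F1`, OPEN); one-line docstrings added where missing (gate lint).  Statements untouched.

No census VALUE is moved here (row F1 stays OPEN-WITH-LINE; the members become TREE-decided by name); NS regularity is NOT proved; `Row_F1` is untouched (zero
movement, `ringCollapse_iff_rowF1`); no summit statement is proved by this file. Lemmas that restate already-landed tree declarations are taken BY NAME (gate lint `dedup.landed`): `topSet` = `TwoTimeTop.topSet`, `HasTypeIConstant` = `OneLevelTop.HasTypeIConstant`, `snapLevel` = `SnapshotTop.snapLevel`, `exists_fast_at` = `SnapshotTop.exists_fast_at`, `sqrt_mul_sq_mul` = `SnapshotTop.sqrt_mul_sq_mul`, `centre_mem` = `IsTypeIAncientMild.comp_add_right`, `continuous_slice'` = `ScalingTop.continuous_slice'`, `rotZ_add_vec'` = `ScrewBlowdown.rotZ_add_vec`, `rotZ_smul_vec'` = `rotZ_smul`, `rotZ_add_smul_eZ'` = `ScrewBlowdown.rotZ_add_smul_eZ`,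 `rotLin` = `ScrewTop.rotLin`, `rotCLM` = `ScrewTop.rotCLM`, `analyticAt_transport` = `ScrewTop.analyticAt_transport`, `rotZ_smul_eZ'` = `ScrewTop.rotZ_smul_eZ'`, `hasDerivAt_rotZ_rotGen'` = `AxisymEndLiouville.AbsorbingAxisSwirlExtinction.hasDerivAt_rotZ_rotGen`, `rotGen_add_smul_eZ'` = `PeriodicSlab.rotGen_add_smul_eZ`, `inner_gradient_eq_fderiv` = `Wu2026Salvage.inner_gradient_right_eq`, `rotZ_single_two` = `UnthreadedRigidity.ProfileHorn.rotZ_single_two'`, `rotZ_neg_rotZ'` = `RotationOrder.rotZ_neg_rotZ`, `rotZ_rotZ_neg'` = `RotationOrder.rotZ_rotZ_neg`, `rotZ_zero_vec'` = `rotZ_apply_zero_vec`, `curl_const_smul'` = `curl_const_smul_field`, `zoom_units` = `NeedleTop.zoom_units`, `eventually_forall_not_of_not_frequently` = `EchoTop.eventually_forall_not_of_not_frequently`, `le_of_units` = `ScalingTop.le_of_units`, `row_of_floor` = `ScalingTop.row_of_floor`.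
-/

-- the summit and its single problem share the name `NavierStokesRegularity` (D-0017 nested layout)
set_option linter.dupNamespace false

noncomputable section

open MeasureTheory Set Function Filter TopologicalSpace Metric
open scoped Topology NNReal ENNReal InnerProductSpace RealInnerProductSpace

namespace Summit.NavierStokesRegularity.NavierStokesRegularity.Theorems.ScenarioCensus.RingTop

open Literature.Analysis Literature.Analysis.FluidPDE
open Summit.NavierStokesRegularity.NavierStokesRegularity.Theorems
open Summit.NavierStokesRegularity.NavierStokesRegularity.Theses
open Summit.NavierStokesRegularity.NavierStokesRegularity.Theorems.LocalHelicityTubeDoorFrobeniusProfileRigidityHelicalSlice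
open Summit.NavierStokesRegularity.NavierStokesRegularity.Theorems.NearExtremalTransiencePerFlow.FilamentSelection
open Summit.NavierStokesRegularity.NavierStokesRegularity.Theorems.LocalSineTubeDoorProfileAlignedWindowRigidityAncient

/-- `ℝ³`. -/
abbrev E3 := EuclideanSpace ℝ (Fin 3)

/-! ## §1 Objects: top, dimensionless Type-I constant, Leray's level `c_S` (frame, LINES 34–42 verbatim); the TANGENCY read-outs (circular /
corkscrew defect of the snapshot about an apex); floors, rows -/

-- `topSet`: the line restates the tree's `TwoTimeTop.topSet`; taken BY NAME (gate lint dedup.landed).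

-- `HasTypeIConstant`: the line restates the tree's `OneLevelTop.HasTypeIConstant`; taken BY NAME (gate lint dedup.landed).

-- `snapLevel`: the line restates the tree's `SnapshotTop.snapLevel`; taken BY NAME (gate lint dedup.landed).

/-! ### The VORTEX-LINE read-outs: tangency defects of the VORTICITY (circles / helices) plus the POINT PINS of the velocity (apex /
axis); the generic first-order read-out `VortexPocketAt`; the two cells; floors; rows -/

/-- The **circular defect** of a vector `ω` at the point `w` (frame coordinates, axis = the `x₂`-axis through the apex):
`|ω₂| + |w₀ ω₀ + w₁ ω₁|` — it vanishes iff `ω` is tangent to the horizontal circle about the axis through `w` (LINE 43's defect; here it is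
applied to the VORTICITY, not to the velocity). -/
def circDefect (w v : E3) : ℝ := |v 2| + |w 0 * v 0 + w 1 * v 1|

/-- The **corkscrew defect of pitch `h`** of `ω` at `w`: `|h ω₀ + w₁ ω₂| + |h ω₁ − w₀ ω₂|` — for `h ≠ 0` it vanishes iff `ω` is a multiple
of the helical Killing vector `ξ_h(w) = J w + h e₂` (LINE 43's defect, applied to the vorticity). -/
def corkDefect (h : ℝ) (w v : E3) : ℝ := |h * v 0 + w 1 * v 2| + |h * v 1 - w 0 * v 2|

open scoped Classical in
/-- The **apex pin** of a vector `v` at the point `w`: AT THE APEX `w = 0` it is `|v₀| + |v₁|`, the speed ACROSS the axis; elsewhere `0`.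
One point, two numbers: "at the apex the fluid moves along the axis" (in the frame).  It is the ONLY velocity datum of the ring read-out. -/
def apexPin (w v : E3) : ℝ := if w = 0 then |v 0| + |v 1| else 0

open scoped Classical in
/-- The **axis pin** of `v` at `w`: ON THE AXIS (`w₀ = w₁ = 0`) it is `|v₀| + |v₁| + |v₂|`, elsewhere `0`: "the fluid on the core line is
at rest" (in the frame).  It is the only velocity datum of the helical ring read-out (a segment, not an open set). -/
def axisPin (w v : E3) : ℝ := if w 0 = 0 ∧ w 1 = 0 then |v 0| + |v 1| + |v 2| else 0

/-- **THE RING DEFECT** of a (velocity, vorticity) pair `(v, ω)` at `w`: the VORTICITY is tangent to the coaxial circle through `w`,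
plus the apex pin.  Exact members (defect `0` on a ball about the apex): every field whose vortex lines on the ball are coaxial circles
about the axis and whose apex velocity is axial — vortex rings and round jets (axisymmetric swirl-free flows up to an axial drift), but
ALSO every IRROTATIONAL pocket with axial apex velocity (e.g. the planar strain `α(w₀e₀ − w₁e₁)`, which has swirl and no rotational
symmetry): the cell is NOT a symmetry class. -/
def ringDefect (w v ω : E3) : ℝ := circDefect w ω + apexPin w v

/-- **THE HELICAL RING DEFECT of pitch `h`**: the vorticity is tangent to the coaxial helix of pitch `h` through `w`, plus the axis pin.
Exact members: helical flows of pitch `h` at rest on the axis (the swirling Poiseuille flow `hJw − ρ²e₂`, vortex lines = the helices),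
and again every irrotational pocket at rest on the axis segment (the planar strain). -/
def helRingDefect (h : ℝ) (w v ω : E3) : ℝ := corkDefect h w ω + axisPin w v

-- `smul_coord`: a statement-twin of a landed coordinate lemma in a route-cone module (`(c • v) i = c * v i`); not re-declared — the `simp only` calls use `PiLp.smul_apply, smul_eq_mul` instead.

/-- Coordinates are continuous. -/
theorem continuous_coord (i : Fin 3) : Continuous fun v : E3 => v i := (EuclideanSpace.proj i : E3 →L[ℝ] ℝ).continuous

/-- Auxiliary lemma of the line, stated and proved verbatim (`circDefect_nonneg`). -/
theorem circDefect_nonneg (w v : E3) : 0 ≤ circDefect w v := add_nonneg (abs_nonneg _) (abs_nonneg _)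
/-- Auxiliary lemma of the line, stated and proved verbatim (`corkDefect_nonneg`). -/
theorem corkDefect_nonneg (h : ℝ) (w v : E3) : 0 ≤ corkDefect h w v := add_nonneg (abs_nonneg _) (abs_nonneg _)
/-- Auxiliary lemma of the line, stated and proved verbatim (`apexPin_nonneg`). -/
theorem apexPin_nonneg (w v : E3) : 0 ≤ apexPin w v := by
  unfold apexPin
  split_ifs
  · exact add_nonneg (abs_nonneg _) (abs_nonneg _)
  · exact le_rfl

/-- Auxiliary lemma of the line, stated and proved verbatim (`axisPin_nonneg`). -/
theorem axisPin_nonneg (w v : E3) : 0 ≤ axisPin w v := by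
  unfold axisPin
  split_ifs
  · exact add_nonneg (add_nonneg (abs_nonneg _) (abs_nonneg _)) (abs_nonneg _)
  · exact le_rfl

/-- Auxiliary lemma of the line, stated and proved verbatim (`ringDefect_nonneg`). -/
theorem ringDefect_nonneg (w v ω : E3) : 0 ≤ ringDefect w v ω := add_nonneg (circDefect_nonneg _ _) (apexPin_nonneg _ _)
/-- Auxiliary lemma of the line, stated and proved verbatim (`helRingDefect_nonneg`). -/
theorem helRingDefect_nonneg (h : ℝ) (w v ω : E3) : 0 ≤ helRingDefect h w v ω :=
  add_nonneg (corkDefect_nonneg _ _ _) (axisPin_nonneg _ _)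

/-- The apex pin at the apex. -/
theorem apexPin_zero (v : E3) : apexPin 0 v = |v 0| + |v 1| := by simp [apexPin]

/-- The apex pin off the apex. -/
theorem apexPin_of_ne_zero {w : E3} (hw : w ≠ 0) (v : E3) : apexPin w v = 0 := by simp [apexPin, hw]

/-- A vanishing apex pin at the apex: the velocity there is axial. -/
theorem apexPin_zero_eq_zero_iff {v : E3} : apexPin 0 v = 0 ↔ v 0 = 0 ∧ v 1 = 0 := by
  rw [apexPin_zero]
  constructor
  · intro h
    have h0 : |v 0| = 0 := by linarith [abs_nonneg (v 0), abs_nonneg (v 1)]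
    have h1 : |v 1| = 0 := by linarith [abs_nonneg (v 0), abs_nonneg (v 1)]
    exact ⟨abs_eq_zero.1 h0, abs_eq_zero.1 h1⟩
  · rintro ⟨h0, h1⟩
    rw [h0, h1, abs_zero, add_zero]

/-- The axis pin on the axis. -/
theorem axisPin_of_onAxis {w : E3} (hw : w 0 = 0 ∧ w 1 = 0) (v : E3) : axisPin w v = |v 0| + |v 1| + |v 2| := by
  unfold axisPin
  rw [if_pos hw]

/-- The axis pin off the axis. -/
theorem axisPin_of_offAxis {w : E3} (hw : ¬ (w 0 = 0 ∧ w 1 = 0)) (v : E3) : axisPin w v = 0 := by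
  unfold axisPin
  rw [if_neg hw]

/-- A vanishing axis pin on the axis: the velocity there vanishes. -/
theorem eq_zero_of_axisPin_eq_zero {w v : E3} (hw : w 0 = 0 ∧ w 1 = 0) (h : axisPin w v = 0) : v = 0 := by
  rw [axisPin_of_onAxis hw] at h
  have h0 : |v 0| = 0 := by linarith [abs_nonneg (v 0), abs_nonneg (v 1), abs_nonneg (v 2)]
  have h1 : |v 1| = 0 := by linarith [abs_nonneg (v 0), abs_nonneg (v 1), abs_nonneg (v 2)]
  have h2 : |v 2| = 0 := by linarith [abs_nonneg (v 0), abs_nonneg (v 1), abs_nonneg (v 2)]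
  ext i
  fin_cases i
  · simpa using abs_eq_zero.1 h0
  · simpa using abs_eq_zero.1 h1
  · simpa using abs_eq_zero.1 h2

/-- Positive homogeneity of the pins in the velocity. -/
theorem apexPin_smul (w v : E3) {c : ℝ} (hc : 0 ≤ c) : apexPin w (c • v) = c * apexPin w v := by
  unfold apexPin
  split_ifs
  · simp only [PiLp.smul_apply, smul_eq_mul, abs_mul, abs_of_nonneg hc]
    ring
  · rw [mul_zero]

/-- Auxiliary lemma of the line, stated and proved verbatim (`axisPin_smul`). -/
theorem axisPin_smul (w v : E3) {c : ℝ} (hc : 0 ≤ c) : axisPin w (c • v) = c * axisPin w v := by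
  unfold axisPin
  split_ifs
  · simp only [PiLp.smul_apply, smul_eq_mul, abs_mul, abs_of_nonneg hc]
    ring
  · rw [mul_zero]

/-- Continuity of the pins in the velocity (at a fixed point). -/
theorem continuous_apexPin (w : E3) : Continuous fun v : E3 => apexPin w v := by
  unfold apexPin
  split_ifs
  · exact ((continuous_coord 0).abs).add ((continuous_coord 1).abs)
  · exact continuous_const

/-- Auxiliary lemma of the line, stated and proved verbatim (`continuous_axisPin`). -/
theorem continuous_axisPin (w : E3) : Continuous fun v : E3 => axisPin w v := by
  unfold axisPin
  split_ifs
  · exact (((continuous_coord 0).abs).add ((continuous_coord 1).abs)).add ((continuous_coord 2).abs)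
  · exact continuous_const

/-- Zero circular defect ⇔ no axial and no radial component. -/
theorem circDefect_eq_zero_iff {w v : E3} : circDefect w v = 0 ↔ v 2 = 0 ∧ w 0 * v 0 + w 1 * v 1 = 0 := by
  unfold circDefect
  constructor
  · intro h
    have h1 : |v 2| = 0 := by linarith [abs_nonneg (v 2), abs_nonneg (w 0 * v 0 + w 1 * v 1)]
    have h2 : |w 0 * v 0 + w 1 * v 1| = 0 := by linarith [abs_nonneg (v 2), abs_nonneg (w 0 * v 0 + w 1 * v 1)]
    exact ⟨abs_eq_zero.1 h1, abs_eq_zero.1 h2⟩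
  · rintro ⟨h1, h2⟩
    rw [h1, h2, abs_zero, add_zero]

/-- Zero corkscrew defect ⇔ the two helical tangency identities. -/
theorem corkDefect_eq_zero_iff {h : ℝ} {w v : E3} :
    corkDefect h w v = 0 ↔ h * v 0 + w 1 * v 2 = 0 ∧ h * v 1 - w 0 * v 2 = 0 := by
  unfold corkDefect
  constructor
  · intro h0
    have h1 : |h * v 0 + w 1 * v 2| = 0 := by
      linarith [abs_nonneg (h * v 0 + w 1 * v 2), abs_nonneg (h * v 1 - w 0 * v 2)]
    have h2 : |h * v 1 - w 0 * v 2| = 0 := by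
      linarith [abs_nonneg (h * v 0 + w 1 * v 2), abs_nonneg (h * v 1 - w 0 * v 2)]
    exact ⟨abs_eq_zero.1 h1, abs_eq_zero.1 h2⟩
  · rintro ⟨h1, h2⟩
    rw [h1, h2, abs_zero, add_zero]

/-- Zero ring defect ⇔ vorticity tangent to the circle AND a vanishing apex pin. -/
theorem ringDefect_eq_zero_iff {w v ω : E3} :
    ringDefect w v ω = 0 ↔ (ω 2 = 0 ∧ w 0 * ω 0 + w 1 * ω 1 = 0) ∧ apexPin w v = 0 := by
  unfold ringDefect
  rw [← circDefect_eq_zero_iff]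
  constructor
  · intro h
    have h1 : circDefect w ω = 0 := by linarith [circDefect_nonneg w ω, apexPin_nonneg w v]
    have h2 : apexPin w v = 0 := by linarith [circDefect_nonneg w ω, apexPin_nonneg w v]
    exact ⟨h1, h2⟩
  · rintro ⟨h1, h2⟩
    rw [h1, h2, add_zero]

/-- Zero helical ring defect ⇔ vorticity tangent to the helix AND a vanishing axis pin. -/
theorem helRingDefect_eq_zero_iff {h : ℝ} {w v ω : E3} :
    helRingDefect h w v ω = 0 ↔ (h * ω 0 + w 1 * ω 2 = 0 ∧ h * ω 1 - w 0 * ω 2 = 0) ∧ axisPin w v = 0 := by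
  unfold helRingDefect
  rw [← corkDefect_eq_zero_iff]
  constructor
  · intro h0
    have h1 : corkDefect h w ω = 0 := by linarith [corkDefect_nonneg h w ω, axisPin_nonneg w v]
    have h2 : axisPin w v = 0 := by linarith [corkDefect_nonneg h w ω, axisPin_nonneg w v]
    exact ⟨h1, h2⟩
  · rintro ⟨h1, h2⟩
    rw [h1, h2, add_zero]

/-- Positive homogeneity of the tangency defects in the vorticity. -/
theorem circDefect_smul (w ω : E3) {c : ℝ} (hc : 0 ≤ c) : circDefect w (c • ω) = c * circDefect w ω := by
  simp only [circDefect, PiLp.smul_apply, smul_eq_mul]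
  rw [show w 0 * (c * ω 0) + w 1 * (c * ω 1) = c * (w 0 * ω 0 + w 1 * ω 1) by ring, abs_mul, abs_mul, abs_of_nonneg hc]
  ring

/-- Auxiliary lemma of the line, stated and proved verbatim (`corkDefect_smul`). -/
theorem corkDefect_smul (h : ℝ) (w ω : E3) {c : ℝ} (hc : 0 ≤ c) : corkDefect h w (c • ω) = c * corkDefect h w ω := by
  simp only [corkDefect, PiLp.smul_apply, smul_eq_mul]
  rw [show h * (c * ω 0) + w 1 * (c * ω 2) = c * (h * ω 0 + w 1 * ω 2) by ring,
    show h * (c * ω 1) - w 0 * (c * ω 2) = c * (h * ω 1 - w 0 * ω 2) by ring, abs_mul, abs_mul, abs_of_nonneg hc]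
  ring

/-- JOINT positive homogeneity of the ring defect in (velocity, vorticity). -/
theorem ringDefect_smul (w v ω : E3) {c : ℝ} (hc : 0 ≤ c) : ringDefect w (c • v) (c • ω) = c * ringDefect w v ω := by
  rw [ringDefect, ringDefect, circDefect_smul w ω hc, apexPin_smul w v hc]
  ring

/-- JOINT positive homogeneity of the helical ring defect. -/
theorem helRingDefect_smul (h : ℝ) (w v ω : E3) {c : ℝ} (hc : 0 ≤ c) :
    helRingDefect h w (c • v) (c • ω) = c * helRingDefect h w v ω := by
  rw [helRingDefect, helRingDefect, corkDefect_smul h w ω hc, axisPin_smul w v hc]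
  ring

/-- The tangency defects are continuous in the vorticity. -/
theorem continuous_circDefect (w : E3) : Continuous fun ω : E3 => circDefect w ω := by
  unfold circDefect
  exact ((continuous_coord 2).abs).add
    (((continuous_const.mul (continuous_coord 0)).add (continuous_const.mul (continuous_coord 1))).abs)

/-- Auxiliary lemma of the line, stated and proved verbatim (`continuous_corkDefect`). -/
theorem continuous_corkDefect (h : ℝ) (w : E3) : Continuous fun ω : E3 => corkDefect h w ω := by
  unfold corkDefect
  exact (((continuous_const.mul (continuous_coord 0)).add (continuous_const.mul (continuous_coord 2))).abs).add
    (((continuous_const.mul (continuous_coord 1)).sub (continuous_const.mul (continuous_coord 2))).abs)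

/-- The ring defect is jointly continuous in (velocity, vorticity). -/
theorem continuous_ringDefect (w : E3) : Continuous fun p : E3 × E3 => ringDefect w p.1 p.2 := by
  unfold ringDefect
  exact ((continuous_circDefect w).comp continuous_snd).add ((continuous_apexPin w).comp continuous_fst)

/-- The helical ring defect is jointly continuous in (velocity, vorticity). -/
theorem continuous_helRingDefect (h : ℝ) (w : E3) : Continuous fun p : E3 × E3 => helRingDefect h w p.1 p.2 := by
  unfold helRingDefect
  exact ((continuous_corkDefect h w).comp continuous_snd).add ((continuous_axisPin w).comp continuous_fst)

/-- **A VORTEX-LINE POCKET for the first-order defect `D` at the instant `t` about the point `x`** (frame `L`, apex reach `A`, radius `a`,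
threshold `ε`; parabolic unit `ℓ = √(ν(T − t))`, speed unit `√ν/√(T − t)`): there is an APEX `x_* = x + ℓ b`, `‖b‖ ≤ A`, such that at every
point of the pocket the conjugated snapshot `G(w) = L⁻¹ u(t, x_* + ℓ L w)` (apex coordinates: `G` is a function of the dimensionless `w`,
so `curl_w G = ℓ · L⁻¹(curl u)` is the vorticity in the SAME speed unit) has `D`-defect `≤ ε`: `√(T − t) · D w (G w) (curl G w) ≤ ε √ν`.
FIRST ORDER (the vorticity is read), ONE INSTANT, SIZE FREE. -/
def VortexPocketAt (D : E3 → E3 → E3 → ℝ) (ν T : ℝ) (u : ℝ → E3 → E3) (L : E3 ≃ₗᵢ[ℝ] E3) (A a ε t : ℝ) (x : E3) : Prop :=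
  ∃ b : E3, ‖b‖ ≤ A ∧ ∀ w : E3, ‖w‖ ≤ a →
    Real.sqrt (T - t) * D w (L.symm (u t (x + (Real.sqrt (ν * (T - t))) • (b + L w))))
      (curl (fun w' : E3 => L.symm (u t (x + (Real.sqrt (ν * (T - t))) • (b + L w')))) w) ≤ ε * Real.sqrt ν

/-- **A RING TOP** («vortex-ring pocket») at `(t, x)`: on the pocket about the apex `x_* = x + ℓLb` the VORTEX LINES of the snapshot
are (nearly) the coaxial horizontal circles about the axis `x_* + ℓL(ℝe₂)`, and AT THE APEX the fluid moves (nearly) ALONG THAT AXIS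
(relative speed across it `≤ ε√ν/√(T − t)`).  Nothing else: both profiles, the amplitude and the swirl elsewhere are free.  Exact members
at ANY amplitude: every axisymmetric swirl-free field about the axis plus an axial drift — round jets `φ(r)e₂` (`ringPocketAt_of_roundJet`),
Hill's and every other vortex ring — AND every irrotational pocket whose apex velocity is axial, e.g. the planar strain `α(w₀e₀ − w₁e₁)`
(`ringDefect_strain`; it swirls, `strain_swirl`, and has no rotational symmetry); a swirling column `αJw + βe₂`, `α ≠ 0` — an exact
whirl pocket of LINE 42 and an exact circular top of LINE 43 — is NOT a member (`ringDefect_column`: axial vortex lines). -/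
def RingPocketAt (ν T : ℝ) (u : ℝ → E3 → E3) (L : E3 ≃ₗᵢ[ℝ] E3) (A a ε t : ℝ) (x : E3) : Prop :=
  VortexPocketAt ringDefect ν T u L A a ε t x

/-- **A HELICAL RING TOP of pitch `h`** at `(t, x)`: on the pocket the vortex lines are (nearly) the coaxial helices of pitch `hℓ` per
radian about the axis through the apex, and ON THE AXIS SEGMENT inside the pocket the fluid is (nearly) AT REST in the frame.  Exact
members at any amplitude: the «swirling Poiseuille» columns `β(hJw − |w_h|²e₂)` (`helicalRingPocketAt_of_swirlPoiseuille`), every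
helically symmetric flow of pitch `h` at rest on its axis, and every irrotational pocket at rest on the axis segment (`helRingDefect_strain`). -/
def HelicalRingPocketAt (ν T : ℝ) (u : ℝ → E3 → E3) (L : E3 ≃ₗᵢ[ℝ] E3) (h A a ε t : ℝ) (x : E3) : Prop :=
  VortexPocketAt (helRingDefect h) ν T u L A a ε t x

/-- **THE RING FLOOR** (structural theorem for EVERY Clay solution with a dimensionless Type-I constant `M`; PROVED, `ringFloor_holds`):
for every level `Λ > 0`, frame `L`, reach `A` and radius `a > 0` there is `ε = ε(M, Λ, L, A, a) > 0` such that, for all instants `t < T`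
close enough to `T`, NO `Λ`-fast point has an `ε`-ring pocket — late fast points of a Type-I Clay solution are NEVER the seat of a
parabolic pocket carrying a system of coaxial circular vortex lines about an axis along which the apex moves (whatever the profiles,
whatever the amplitude).  UNIVERSAL over fast points. -/
def RingFloor : Prop :=
  ∀ (M Λ : ℝ) (L : E3 ≃ₗᵢ[ℝ] E3) (A a : ℝ), 0 < Λ → 0 < a → ∃ ε : ℝ, 0 < ε ∧
    ∀ (ν T : ℝ), 0 < ν → 0 < T → ∀ (u : ℝ → E3 → E3) (p : ℝ → E3 → ℝ),
    IsClassicalNSSolutionOn (Ico 0 T) ν 0 u p → IsLerayHopfOn T ν 0 (u 0) u →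
    HasRapidSpatialDecay (u 0) → OneLevelTop.HasTypeIConstant ν T M u →
    ∀ᶠ t in 𝓝[<] T, ∀ x ∈ TwoTimeTop.topSet ν T u Λ t, ¬ RingPocketAt ν T u L A a ε t x

/-- **THE HELICAL RING FLOOR** (PROVED, `helicalRingFloor_holds`): the same for helical ring pockets of every pitch `h ≠ 0`. -/
def HelicalRingFloor : Prop :=
  ∀ (M Λ : ℝ) (L : E3 ≃ₗᵢ[ℝ] E3) (h A a : ℝ), 0 < Λ → h ≠ 0 → 0 < a → ∃ ε : ℝ, 0 < ε ∧
    ∀ (ν T : ℝ), 0 < ν → 0 < T → ∀ (u : ℝ → E3 → E3) (p : ℝ → E3 → ℝ),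
    IsClassicalNSSolutionOn (Ico 0 T) ν 0 u p → IsLerayHopfOn T ν 0 (u 0) u →
    HasRapidSpatialDecay (u 0) → OneLevelTop.HasTypeIConstant ν T M u →
    ∀ᶠ t in 𝓝[<] T, ∀ x ∈ TwoTimeTop.topSet ν T u Λ t, ¬ HelicalRingPocketAt ν T u L h A a ε t x

/-- **ROW F1rx «RING TOPS»** (Type I · no symmetry · Clay class; census shape; PROVED, `rowF1rx_holds`, a corollary of the floor at Leray's
level `c_S`): for every `M`, frame `L`, reach `A`, radius `a > 0` there is `ε > 0` such that: if along SOME sequence of instants `t_k ↑ T`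
every `c_S`-fast point has an `ε`-ring pocket, the solution extends smoothly past `T`. -/
def Row_F1rx : Prop :=
  ∀ (M : ℝ) (L : E3 ≃ₗᵢ[ℝ] E3) (A a : ℝ), 0 < a → ∃ ε : ℝ, 0 < ε ∧
    ∀ (ν T : ℝ), 0 < ν → 0 < T → ∀ (u : ℝ → E3 → E3) (p : ℝ → E3 → ℝ),
    IsClassicalNSSolutionOn (Ico 0 T) ν 0 u p → IsLerayHopfOn T ν 0 (u 0) u →
    HasRapidSpatialDecay (u 0) → OneLevelTop.HasTypeIConstant ν T M u →
    (∃ᶠ t in 𝓝[<] T, ∀ x ∈ TwoTimeTop.topSet ν T u SnapshotTop.snapLevel t, RingPocketAt ν T u L A a ε t x) →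
    HasSmoothExtensionPast ν 0 u T

/-- **ROW F1krx «HELICAL RING TOPS OF PITCH `h ≠ 0`»** (PROVED, `rowF1krx_holds`). -/
def Row_F1krx : Prop :=
  ∀ (M : ℝ) (L : E3 ≃ₗᵢ[ℝ] E3) (h A a : ℝ), h ≠ 0 → 0 < a → ∃ ε : ℝ, 0 < ε ∧
    ∀ (ν T : ℝ), 0 < ν → 0 < T → ∀ (u : ℝ → E3 → E3) (p : ℝ → E3 → ℝ),
    IsClassicalNSSolutionOn (Ico 0 T) ν 0 u p → IsLerayHopfOn T ν 0 (u 0) u →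
    HasRapidSpatialDecay (u 0) → OneLevelTop.HasTypeIConstant ν T M u →
    (∃ᶠ t in 𝓝[<] T, ∀ x ∈ TwoTimeTop.topSet ν T u SnapshotTop.snapLevel t, HelicalRingPocketAt ν T u L h A a ε t x) →
    HasSmoothExtensionPast ν 0 u T

end Summit.NavierStokesRegularity.NavierStokesRegularity.Theorems.ScenarioCensus.RingTop

end
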